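import Literature.MathematicalPhysics.QuantumFieldTheory.Balaban1983to89.Node00.Record12LocalLawsTwoScale
import Literature.MathematicalPhysics.QuantumFieldTheory.Balaban1983to89.Node00.TkNoExpansionStepZero

/-!
# DAG node N11 — THE DOOR THE FLAG №1 CURE OPENS, IN KERNEL: under 12b's row of record AS RE-TYPED BY W2∕T1′ (print's TWO-SCALE locality, [III] (3.1)–(3.4)) a residual
# factor `ζ0_k` MAY READ THE NEW GAUGE FIELD `V_{k+1}` — the residual `ζ0 k Y ω := g Y ((ω (k+1)).1)` (print's small-field functions (3.2) of `V_{k+1}`) obeys the row,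
# violates the DISPLAYED ONE-SCALE LAW `hzh` of the located degeneracy (g19∕W2 editions) as soon as `g Y` is non-constant, and its value at 11a's base configuration
# `base_{k+1}(V′)` IS `g Y V′` — it READS the coarse field, so the «`V′`-independent constant `c`» of `…N11TopPairLocalResidual` §1–§2 is no longer forced

HEADER — WORK-UNIT METADATA.  Cell `pub-ymgap`, YM-PLAN Track A (HUMAN RULING D-0062), seat `pub-ymgap-dag-n11-d` (g32; v1.1 §3 by g33) on NODE n11 [B14]; route `BalabanUVNodes`, item K1⁹ =
stmt-QuantumFields-27364 (helper lane, `--kind proof --supports 27364 --as helper`, count-neutral).  Written right after the W2 window (director-ym №272∕№278∕№283; 13∕13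
ACCEPTED; dag-lead CLOSURE PASS GREEN 2026-08-29T12:54Z).  [III] = [Balaban1988Convergent].

WHY THIS FILE (located, count-neutral).  The W2 editions re-keyed this seat's g19 necessary-condition readings («the first 𝐓-law serves every top pair only degenerately») on a
DISPLAYED one-scale law `hzh : ω k = ω′ k → ζ0 k Y ω = ζ0 k Y ω′`; the reviewers asked, rightly, that the text say the row of record no longer implies `hzh`.  This file is the
kernel certificate of that sentence and of the cure's purpose: (i) the two-scale row `TkResidualW.LocalLaws` (post-T1′) is INHABITED by residuals that are NOT one-scale — for every
profile `g : Set (sites) → GaugeField_{k+1} → ℝ`, every residual `Z` of the NEW-FIELD SHAPE `Z.ζ0 j Y ω = if j = k then g Y (ω (k+1)).1 else 1` (generation `k` reads `(ω (k+1)).1` only;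
such `Z` exist, `exists_newFieldShape`) obeys `LocalLaws` and 12a's `Laws` (for `g ≥ 0`), and `hzh` FAILS for it whenever `g Y V ≠ g Y V′` for two coarse fields (witnessed on 11a's base configurations, which agree at
scale `k`); (ii) at 11a's base configuration `base_{k+1}(V′)` its `ζ0_k(Y)` EQUALS `g Y V′` — the exact spot where `…N11TopPairLocalResidual.WtOfRecord₁₃H_ζ_baseCfg_eq_of_localLaws`
produced a `V′`-independent constant under the one-scale law.  So a witness `θ` whose step residual carries print's (3.2) cut-off of the new field is OUTSIDE the degeneracy
class — the object K0a∕K0b's next pin has to supply (not built here: no `Stage13HParams` is constructed, no pin of record is touched).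

WHAT THIS FILE PROVES (0 `sorry`, 0 `def`; standard axioms).  All theorems take a residual `Z` with the NEW-FIELD SHAPE hypothesis `hZ : ∀ j Y ω, Z.ζ0 j Y ω = if j = k then g Y (ω (k+1)).1 else 1`.
§1 `exists_newFieldShape` (such `Z` exist, with `quad = 0`) · ★ `localLaws_of_newFieldShape` (the TWO-SCALE ROW HOLDS) · `localLaws₂_of_newFieldShape` · `laws_of_newFieldShape` (12a's `ζ0 ≥ 0` for `g ≥ 0`).
§2 ★★ `ζ0_baseCfg_of_newFieldShape` (`ζ0_k(Y)(base_{k+1} V′) = g Y V′`: READS the coarse field) · ★★ `not_oneScale_of_newFieldShape` (`hzh` fails as soon as `g Y V ≠ g Y V′`) ·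
   ★★ `exists_localLaws_and_not_oneScale` (headline: a residual obeying the row of record but NOT the displayed one-scale law, for every separating profile).
§3 (v1.1, g33 — ref-K READ-506 NIT n1) `exists_profile_separating` (distinct fields are separated by a profile) · `exists_gaugeField_ne` (two distinct `SU(N)` gauge fields on every
   torus once `N ≥ 2`: `1` and the constant `diag(i, −i, 1, …, 1)`) · ★★ `exists_localLaws_and_not_oneScale_of_two_le` (the headline OUTRIGHT at `N ≥ 2`: the separating pair is exhibited).

HONEST FRAMING.  Helper lane of K1⁹; an inhabitation∕separation certificate for the re-typed row (count-neutral, LOCATED); nothing of Bałaban asserted or refuted — print's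
`ζ(Ω^c_{k+1})` is a specific resummation (p.267), of which `g` is only the SHAPE «a function of `V_{k+1}` on the new region»; K1⁹ `∃θ` NOT refuted, NOT advanced; N11 NOT
discharged; counts unmoved (discharged 8∕27).  One finite four-torus programme at fixed `ε = L^{−K}`; NOT ℝ⁴, NOT OS, NOT a mass gap, NOT Clay.  No `sorry`, `axiom`, `def`,
`instance`, `notation`.  Sources (SHAPE only): [III] (2.18) p.257, (2.21) p.258, (3.1) p.264, (3.2)–(3.4) p.265, p.267.
-/

noncomputable section

open scoped BigOperators

namespace Summit.QuantumFields.YangMills.Theorems.BalabanUVNodesN11TwoScaleRowDoor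

open Literature.MathematicalPhysics.QuantumFieldTheory.Balaban1983to89 T4Continuum Node00 Node00.Tk

variable {F : T4Family} {N : ℕ} [NeZero N] {V : Type} [Zero V]
variable {K k : ℕ} {g : Set (Site (F.P K) 0) → GaugeField (F.P K) (k + 1) (SU N) → ℝ} {Z : TkResidualW F N V K}

/-! ## §1. The new-field shape and the rows it obeys -/

omit [NeZero N] [Zero V] in
/-- **RESIDUALS OF THE NEW-FIELD SHAPE EXIST** (with `quad = 0`): `ζ0 k Y ω := g Y ((ω (k+1)).1)` — a function of the NEW gauge field only, the shape of print's (3.2)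
small-field functions `χ_{k+1}(P_{k+1})` of `V_{k+1}` inside `ζ(Ω^c_{k+1})` (p.267) — and `ζ0 j := 1` at every other generation. [cite: Balaban1988Convergent, (3.2) p.265, p.267 (shape only)] -/
theorem exists_newFieldShape (K k : ℕ) (g : Set (Site (F.P K) 0) → GaugeField (F.P K) (k + 1) (SU N) → ℝ) :
    ∃ Z : TkResidualW F N V K, (∀ j Y ω, Z.ζ0 j Y ω = if j = k then g Y (ω (k + 1)).1 else 1) ∧ ∀ j Y ω, Z.quad j Y ω = 0 :=
  ⟨⟨fun j Y ω => if j = k then g Y (ω (k + 1)).1 else 1, fun _ _ _ => 0⟩, fun _ _ _ => rfl, fun _ _ _ => rfl⟩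

omit [NeZero N] [Zero V] in
/-- ★ **THE ROW OF RECORD (TWO-SCALE SINCE W2∕T1′) HOLDS** for every residual of the new-field shape: `ζ0 j` reads `ω j` and `(ω (j+1)).1` only — in fact only the
latter, at `j = k`. [cite: Balaban1988Convergent, (3.1) p.264, (3.2)–(3.4) p.265, p.267] -/
theorem localLaws_of_newFieldShape (hZ : ∀ j Y ω, Z.ζ0 j Y ω = if j = k then g Y (ω (k + 1)).1 else 1) : Z.LocalLaws := by
  constructor
  intro j Y ω ω' _ h1
  rw [hZ, hZ]
  by_cases hj : j = k
  · subst hj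
    rw [if_pos rfl, if_pos rfl, h1]
  · rw [if_neg hj, if_neg hj]

omit [NeZero N] [Zero V] in
/-- … hence node00's named two-scale law `LocalLaws₂` as well (the two coincide after the cure). [cite: Balaban1988Convergent, (3.2)–(3.4) p.265, p.267 (bookkeeping)] -/
theorem localLaws₂_of_newFieldShape (hZ : ∀ j Y ω, Z.ζ0 j Y ω = if j = k then g Y (ω (k + 1)).1 else 1) : Z.LocalLaws₂ :=
  (localLaws_of_newFieldShape hZ).localLaws₂

omit [NeZero N] [Zero V] in
/-- 12a's law `ζ0 ≥ 0` for a nonnegative profile. [cite: Balaban1988Convergent, p.267 (bookkeeping)] -/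
theorem laws_of_newFieldShape (hZ : ∀ j Y ω, Z.ζ0 j Y ω = if j = k then g Y (ω (k + 1)).1 else 1) (hg : ∀ Y U, 0 ≤ g Y U) : Z.Laws := by
  refine ⟨fun j Y ω => ?_⟩
  rw [hZ]
  by_cases hj : j = k
  · rw [if_pos hj]
    exact hg _ _
  · rw [if_neg hj]
    exact zero_le_one

/-! ## §2. It reads the coarse field at 11a's base configuration; the displayed one-scale law fails -/

omit [NeZero N] in
/-- ★★ **AT 11a's BASE CONFIGURATION `base_{k+1}(V′)` A NEW-FIELD-SHAPE RESIDUAL READS THE COARSE FIELD**: `ζ0_k(Y)(base_{k+1} V′) = g Y V′` — compare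
`…N11TopPairLocalResidual.WtOfRecord₁₃H_ζ_baseCfg_eq_of_localLaws`, which under the ONE-SCALE law makes this value independent of `V′`.
[cite: Balaban1988Convergent, (2.18) p.257, (3.2) p.265, p.267] -/
theorem ζ0_baseCfg_of_newFieldShape (hZ : ∀ j Y ω, Z.ζ0 j Y ω = if j = k then g Y (ω (k + 1)).1 else 1)
    (Y : Set (Site (F.P K) 0)) (V' : GaugeField (F.P K) (k + 1) (SU N)) :
    Z.ζ0 k Y (baseCfg (V := V) (k + 1) V') = g Y V' := by
  rw [hZ, if_pos rfl]
  congr 1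
  exact funext fun b => baseCfg_fst_self (V := V) (k + 1) V' b

omit [NeZero N] in
/-- ★★ **THE DISPLAYED ONE-SCALE LAW `hzh` FAILS** for a new-field-shape residual as soon as the profile separates two coarse fields on some region: the base
configurations `base_{k+1}(V)` and `base_{k+1}(V′)` agree at scale `k` (both `(1, 0)`) while `ζ0_k(Y)` takes the values `g Y V ≠ g Y V′` — so the located degeneracy
of the g19∕W2 readings (hypothesis `hzh`) does not apply to a parameter whose step residual has this shape. [cite: Balaban1988Convergent, (2.18) p.257, (3.2) p.265, p.267] -/
theorem not_oneScale_of_newFieldShape (hZ : ∀ j Y ω, Z.ζ0 j Y ω = if j = k then g Y (ω (k + 1)).1 else 1)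
    {Y : Set (Site (F.P K) 0)} {U U' : GaugeField (F.P K) (k + 1) (SU N)} (hsep : g Y U ≠ g Y U') :
    ¬ ∀ (Y : Set (Site (F.P K) 0)) (ω ω' : MultiCfg (F.P K) (SU N) V), ω k = ω' k → Z.ζ0 k Y ω = Z.ζ0 k Y ω' := by
  intro h
  apply hsep
  have hk : (baseCfg (V := V) (k + 1) U) k = (baseCfg (V := V) (k + 1) U') k :=
    Prod.ext (by rw [baseCfg_fst_of_ne (V := V) (Nat.succ_ne_self k).symm U, baseCfg_fst_of_ne (V := V) (Nat.succ_ne_self k).symm U'])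
      (by simp only [baseCfg_snd])
  have := h Y _ _ hk
  rwa [ζ0_baseCfg_of_newFieldShape hZ, ζ0_baseCfg_of_newFieldShape hZ] at this

omit [NeZero N] in
/-- ★★ **HEADLINE — THE RE-TYPED ROW IS STRICTLY WEAKER THAN THE DISPLAYED ONE-SCALE LAW**: for every generation `k` and every profile `g` separating two coarse fields on
some region there is a residual `Z` obeying 12b's row of record `TkResidualW.LocalLaws` (two-scale since W2∕T1′) for which `hzh` FAILS at generation `k`.  This is the kernel
form of the sentence every W2 edition now carries («the row `zhLocal` does NOT imply `hzh`»). [cite: Balaban1988Convergent, (3.1) p.264, (3.2)–(3.4) p.265, p.267, (2.18) p.257] -/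
theorem exists_localLaws_and_not_oneScale (K k : ℕ) (g : Set (Site (F.P K) 0) → GaugeField (F.P K) (k + 1) (SU N) → ℝ)
    {Y : Set (Site (F.P K) 0)} {U U' : GaugeField (F.P K) (k + 1) (SU N)} (hsep : g Y U ≠ g Y U') :
    ∃ Z : TkResidualW F N V K, Z.LocalLaws ∧
      ¬ ∀ (Y : Set (Site (F.P K) 0)) (ω ω' : MultiCfg (F.P K) (SU N) V), ω k = ω' k → Z.ζ0 k Y ω = Z.ζ0 k Y ω' := by
  obtain ⟨Z, hZ, -⟩ := exists_newFieldShape (V := V) K k g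
  exact ⟨Z, localLaws_of_newFieldShape hZ, not_oneScale_of_newFieldShape hZ hsep⟩

/-! ## §3. The separating witness EXHIBITED (v1.1, answering ref-K READ-506 NIT n1): for `N ≥ 2` two distinct new gauge fields exist and every such pair is
separated by a profile — so the headline holds OUTRIGHT at `N ≥ 2` (the A2 «joint inhabitation» of §2 is discharged, not merely declared) -/

omit [NeZero N] [Zero V] in
/-- Any two distinct coarse fields are separated on every region by SOME profile (the indicator of the first one). [folklore] -/
theorem exists_profile_separating {U U' : GaugeField (F.P K) (k + 1) (SU N)} (hne : U ≠ U') :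
    ∃ g : Set (Site (F.P K) 0) → GaugeField (F.P K) (k + 1) (SU N) → ℝ, ∀ Y, g Y U ≠ g Y U' := by
  classical
  refine ⟨fun _ W => if W = U then 1 else 0, fun _ => ?_⟩
  show (if U = U then (1 : ℝ) else 0) ≠ (if U' = U then 1 else 0)
  rw [if_pos rfl, if_neg (Ne.symm hne)]
  exact one_ne_zero

omit [NeZero N] in
/-- **TWO DISTINCT `SU(N)`-VALUED GAUGE FIELDS EXIST ON EVERY TORUS `T^{(j)}` ONCE `N ≥ 2`**: the trivial field `U ≡ 1` and the constant field
`U′ ≡ diag(i, −i, 1, …, 1)` (unitary, determinant `i·(−i) = 1`), which differ at the bond `⟨0, e_0⟩` (a bond exists since `d ≥ 1`) in the entry `(0,0)`. [folklore] -/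
theorem exists_gaugeField_ne (hN : 2 ≤ N) (P : Params) (j : ℕ) : ∃ U U' : GaugeField P j (SU N), U ≠ U' := by
  have h0 : 0 < N := by omega
  have h1 : 1 < N := by omega
  set a : Fin N := ⟨0, h0⟩ with ha
  set b : Fin N := ⟨1, h1⟩ with hb
  have hab : a ≠ b := by
    rw [ha, hb, ne_eq, Fin.mk.injEq]
    exact Nat.zero_ne_one
  set d : Fin N → ℂ := Pi.mulSingle a Complex.I * Pi.mulSingle b (-Complex.I) with hd
  have hD : Matrix.diagonal d ∈ Matrix.specialUnitaryGroup (Fin N) ℂ := by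
    rw [Matrix.mem_specialUnitaryGroup_iff]
    refine ⟨?_, ?_⟩
    · rw [Matrix.mem_unitaryGroup_iff, Matrix.star_eq_conjTranspose, Matrix.diagonal_conjTranspose,
        Matrix.diagonal_mul_diagonal, ← Matrix.diagonal_one]
      congr 1; funext i; simp only [hd, Pi.mul_apply, Pi.star_apply]
      rcases eq_or_ne i a with rfl | hia
      · simp [Pi.mulSingle_eq_of_ne hab, Complex.conj_I]
      · rcases eq_or_ne i b with rfl | hib
        · simp [Pi.mulSingle_eq_of_ne hia, Complex.conj_I]
        · simp [Pi.mulSingle_eq_of_ne hia, Pi.mulSingle_eq_of_ne hib]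
    · rw [Matrix.det_diagonal]
      simp only [hd, Pi.mul_apply]
      rw [Finset.prod_mul_distrib, Fintype.prod_pi_mulSingle', Fintype.prod_pi_mulSingle', mul_neg, Complex.I_mul_I, neg_neg]
  refine ⟨fun _ => 1, fun _ => ⟨Matrix.diagonal d, hD⟩, fun h => ?_⟩
  have hb0 : ((1 : SU N) : Matrix (Fin N) (Fin N) ℂ) a a = (Matrix.diagonal d) a a :=
    congr_arg (fun M : SU N => (M : Matrix (Fin N) (Fin N) ℂ) a a) (congr_fun h ⟨default, ⟨0, P.hd⟩⟩)
  rw [Matrix.diagonal_apply_eq, hd, Pi.mul_apply, Pi.mulSingle_eq_same, Pi.mulSingle_eq_of_ne hab, mul_one] at hb0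
  have h11 : ((1 : SU N) : Matrix (Fin N) (Fin N) ℂ) a a = 1 := by simp
  rw [h11] at hb0
  have hre := congr_arg Complex.re hb0
  rw [Complex.one_re, Complex.I_re] at hre
  exact one_ne_zero hre

omit [NeZero N] in
/-- ★★ **HEADLINE, UNCONDITIONAL AT `N ≥ 2`** (ref-K READ-506 NIT n1 discharged): on every torus of the family and at every generation `k` there ARE a profile `g`
and a residual `Z` obeying 12b's row of record `TkResidualW.LocalLaws` (TWO-SCALE since W2∕T1′) for which the DISPLAYED ONE-SCALE LAW `hzh` FAILS at generation `k` —
the separating pair of §2 is now exhibited (`exists_gaugeField_ne` + `exists_profile_separating`), so nothing is left declared-but-uninhabited in this file for `N ≥ 2`.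
(`N = 1`: `SU(1)` is trivial, every profile is constant in the field, and the two laws coincide — the regime is empty by content, not by omission.)
[cite: Balaban1988Convergent, (3.1) p.264, (3.2)–(3.4) p.265, p.267, (2.18) p.257] -/
theorem exists_localLaws_and_not_oneScale_of_two_le (hN : 2 ≤ N) (K k : ℕ) :
    ∃ (g : Set (Site (F.P K) 0) → GaugeField (F.P K) (k + 1) (SU N) → ℝ) (Z : TkResidualW F N V K), Z.LocalLaws ∧
      (∀ j Y ω, Z.ζ0 j Y ω = if j = k then g Y (ω (k + 1)).1 else 1) ∧
      ¬ ∀ (Y : Set (Site (F.P K) 0)) (ω ω' : MultiCfg (F.P K) (SU N) V), ω k = ω' k → Z.ζ0 k Y ω = Z.ζ0 k Y ω' := by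
  obtain ⟨U, U', hne⟩ := exists_gaugeField_ne hN (F.P K) (k + 1)
  obtain ⟨g, hg⟩ := exists_profile_separating (F := F) (K := K) (k := k) hne
  obtain ⟨Z, hZ, -⟩ := exists_newFieldShape (V := V) K k g
  exact ⟨g, Z, localLaws_of_newFieldShape hZ, hZ, not_oneScale_of_newFieldShape hZ (hg (Set.univ))⟩

end Summit.QuantumFields.YangMills.Theorems.BalabanUVNodesN11TwoScaleRowDoor

end
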